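import Mathlib
import HarnessLib
import Summits.NavierStokesRegularity.NavierStokesRegularity.Theorems.PoloidalWindowDoorLrcModEntireRidgeQuasiconvex
import Summits.NavierStokesRegularity.NavierStokesRegularity.Theorems.PoloidalWindowDoorLrcModEntireRidgeSecondOrder
import Summits.NavierStokesRegularity.NavierStokesRegularity.Theorems.PoloidalWindowDoorLrcModEntireLateralLevel

/-!
# Item `LrcModEntire` (stmt-NavierStokesRegularity-20428), registry twist_split v7 — the «ridge quasiconvexity» lever ASSEMBLED (memo `Cruxes/LrcModEntire/T2B-g14.md` §9):
# Peakless + joint continuity + a tube chart around a hot arc + uniform second-order cross-section data ⇒ THE RIDGE COEFFICIENT `θ_νz²/κ + θ_zz` IS QUASICONVEX ALONG THE ARC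

LEAD of item 20428 ns-poloidal-K2-p3 g14 (`--supports stmt-NavierStokesRegularity-20428 --as helper`).  Composition of the landed rungs (Q0) `…PeaklessPlanarMaxPrinciple` (p704227),
(Q1) `…RidgeQuasiconvex` (p704655), (Q2) `…RidgeSecondOrder` (p705187), (LL) `…LateralLevel` (p705501); the Taylor input is the conclusion of (H) `…RidgeTaylor.ridgeExpansion_of_contDiff`
applied on `E = ℝ × ℝ` to the chart cross-sections.  CLASS-FREE: the field `v` is arbitrary; the hypotheses are

* the Peakless binder of the K2 cells VERBATIM and joint continuity of `v` on the open backward slab (class clauses);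
* a tube chart `e : OpenPartialHomeomorph (ℝ × ℝ) (ℝ × ℝ)` with `[a₁,a₂] × [−r,r] ⊆ e.source`, read at height `z₀` through `P z₀ q = (q.1, q.2, z₀)` (defining equation);
* at `(t, z₀) = (−1, 0)`: the centre curve is HOT (`σv₂ = N`) and the lateral boundary is not (`σv₂ < N`);
* for every arclength `s ∈ [a₁,a₂]`, the cross-section function `g_s(n,z) := σv₂(−1, P z (e(s,n)))` has the critical second-order expansion
  `|g_s(n,z) − (N − ½κ(s)n² + α(s)nz + ½β(s)z²)| ≤ C₃(|n|+|z|)³` (all `n, z`; = (H) with `‖D³g_s‖ ≤ C₃`, `∇g_s(0) = 0`), with UNIFORM constants `κ(s) ≥ κ₀ > 0`, `|α(s)| ≤ A`,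
  and a thin tube `64·C₃·r ≤ κ₀`.

CONCLUSION `quasiconvexOn_ridgeCoeff_of_peakless`: **`s ↦ α(s)²/κ(s) + β(s)` is `QuasiconvexOn ℝ [a₁,a₂]`** — along a hot arc the second-order ridge coefficient has no interior strict
local maximum.  In the (TH) column (ridge law: `κ`, `β` constant along the web) this is the quasiconvexity of `|∇ₕ∂_z v₂|²` along every hot branch
(`…RidgeSecondOrder.quasiconvexOn_sq_of_ridgeLaw`); on a branch periodic / recurrent along itself it forces constancy (`…RidgeQuasiconvex.QuasiconvexOn.eq_of_periodic`), and on an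
unbounded branch it feeds the hull homogenisation (Q3) (`…TwistingTHRidgeQuasiconvexTools.exists_tendsto_atTop_of_abs_le`, LINE 21 `ClassCompactness`).

WHAT THIS IS NOT: not a claim about Navier–Stokes regularity — a necessary condition on the hot ridge of the research stubs `stub_T2b` / `stub_C2a'` / `stub_C2b'` (bears_on LADDER-NS N0,
item 20428 / crux 19708; both OPEN, ⟨27893⟩ OPEN).
-/

noncomputable section

-- the summit and its single sub-problem share the name (CONVENTIONS §1), as in every Theorems file
set_option linter.dupNamespace false

namespace Summit.NavierStokesRegularity.NavierStokesRegularity.Theorems.PoloidalWindowDoorLrcModEntireRidgeAssembly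

open Set Filter Topology Metric Function
open Summit.NavierStokesRegularity.NavierStokesRegularity.Theorems.PoloidalWindowDoorLrcModEntireRidgeQuasiconvex
open Summit.NavierStokesRegularity.NavierStokesRegularity.Theorems.PoloidalWindowDoorLrcModEntireRidgeSecondOrder
open Summit.NavierStokesRegularity.NavierStokesRegularity.Theorems.PoloidalWindowDoorLrcModEntireLateralLevel

variable {v : ℝ → EuclideanSpace ℝ (Fin 3) → EuclideanSpace ℝ (Fin 3)}

/-- A slice `y ↦ v(t,y)₂`, `t < 0`, is continuous when `v` is jointly continuous on the open backward slab. -/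
theorem continuous_slice_two (hcont : ContinuousOn (uncurry v) (Iio (0 : ℝ) ×ˢ univ)) {t : ℝ} (ht : t < 0) :
    Continuous fun y : EuclideanSpace ℝ (Fin 3) => v t y 2 := by
  have h : Continuous fun y : EuclideanSpace ℝ (Fin 3) => v t y :=
    hcont.comp_continuous (continuous_const.prodMk continuous_id) fun y => ⟨ht, mem_univ _⟩
  exact (EuclideanSpace.proj (𝕜 := ℝ) (2 : Fin 3)).continuous.comp h

/-- **THE RIDGE COEFFICIENT IS QUASICONVEX ALONG A HOT ARC.**  See the module docstring. -/
theorem quasiconvexOn_ridgeCoeff_of_peakless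
    (hpk : ∀ (s z₀ σ M : ℝ) (K O : Set (EuclideanSpace ℝ (Fin 3))), s < 0 →
      ((σ = 1 ∨ σ = -1) ∧ IsCompact K ∧ K.Nonempty ∧ (∀ y ∈ K, y 2 = z₀ ∧ σ * v s y 2 = M) ∧
        IsOpen O ∧ K ⊆ O ∧ (∀ y ∈ O, y 2 = z₀ → σ * v s y 2 ≤ M) ∧
        (∀ y ∈ O, y 2 = z₀ → σ * v s y 2 = M → y ∈ K)) → False)
    (hcont : ContinuousOn (uncurry v) (Iio (0 : ℝ) ×ˢ univ)) {σ N : ℝ} (hσ : σ = 1 ∨ σ = -1)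
    (e : OpenPartialHomeomorph (ℝ × ℝ) (ℝ × ℝ)) {a₁ a₂ r : ℝ} (ha : a₁ ≤ a₂) (hr : 0 < r) (hsrc : Icc a₁ a₂ ×ˢ Icc (-r) r ⊆ e.source)
    {P : ℝ → ℝ × ℝ → EuclideanSpace ℝ (Fin 3)} (hP : ∀ z₀ q, P z₀ q = WithLp.toLp 2 ![q.1, q.2, z₀])
    (hlat0 : ∀ a ∈ Icc a₁ a₂, ∀ n : ℝ, (n = r ∨ n = -r) → σ * v (-1) (P 0 (e (a, n))) 2 < N)
    (hmid0 : ∀ a ∈ Icc a₁ a₂, σ * v (-1) (P 0 (e (a, 0))) 2 = N)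
    {κ α β : ℝ → ℝ} {κ₀ A C₃ : ℝ} (hκ₀ : 0 < κ₀) (hC₃ : 0 ≤ C₃) (hA : 0 ≤ A) (hthin : 64 * C₃ * r ≤ κ₀)
    (hκ : ∀ s ∈ Icc a₁ a₂, κ₀ ≤ κ s) (hαA : ∀ s ∈ Icc a₁ a₂, |α s| ≤ A)
    (hexp : ∀ s ∈ Icc a₁ a₂, ∀ n z : ℝ,
      |σ * v (-1) (P z (e (s, n))) 2 - (N - κ s / 2 * n ^ 2 + α s * n * z + β s / 2 * z ^ 2)| ≤ C₃ * (|n| + |z|) ^ 3) :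
    QuasiconvexOn ℝ (Icc a₁ a₂) fun s => α s ^ 2 / κ s + β s := by
  -- (LL): the tube level for all nearby heights at time `−1`
  obtain ⟨δ, hδ, m, hLL⟩ := lateralLevel_persist hcont e ha hsrc hr.le hP hlat0 hmid0
  have hvc : Continuous fun y : EuclideanSpace ℝ (Fin 3) => v (-1) y 2 := continuous_slice_two hcont (by norm_num)
  -- the cross-section maximum `R s z`
  set R : ℝ → ℝ → ℝ := fun s z => sSup ((fun n : ℝ => σ * v (-1) (P z (e (s, n))) 2) '' Icc (-r) r) with hR
  -- the admissible height range
  set δ' : ℝ := min (δ / 2) (κ₀ * r / (A + 1)) with hδ'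
  have hδ'0 : 0 < δ' := lt_min (by linarith) (by positivity)
  have hδ'δ : δ' < δ := lt_of_le_of_lt (min_le_left _ _) (by linarith)
  have hδ'A : δ' ≤ κ₀ * r / (A + 1) := min_le_right _ _
  -- (Q1): quasiconvexity of `s ↦ R s z` for `|z| < δ`
  have hqc : ∀ z : ℝ, 0 < |z| → |z| ≤ δ' → QuasiconvexOn ℝ (Icc a₁ a₂) fun s => R s z := by
    intro z _ hzδ'
    obtain ⟨hlat, hmid⟩ := hLL (-1) z (by norm_num [hδ]) (lt_of_le_of_lt hzδ' hδ'δ)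
    exact crossSectionMax_quasiconvexOn_of_peakless hpk (by norm_num) hσ hvc (hP z) e hr.le hsrc hlat hmid
  -- (Q2): the uniform expansion of `R s z`
  set C' : ℝ := 16 * C₃ * A ^ 3 / κ₀ ^ 3 + 4 * C₃ with hC'
  have hexpR : ∀ s ∈ Icc a₁ a₂, ∀ z : ℝ, 0 < |z| → |z| ≤ δ' →
      |R s z - N - (α s ^ 2 / κ s + β s) / 2 * z ^ 2| ≤ C' * |z| ^ 3 := by
    intro s hs z hz0 hzδ'
    have hκs : 0 < κ s := lt_of_lt_of_le hκ₀ (hκ s hs)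
    have hthin_s : 64 * C₃ * r ≤ κ s := hthin.trans (hκ s hs)
    -- continuity of the cross-sections at every height
    have hsec : ∀ z' : ℝ, |z'| ≤ |z| → ContinuousOn (fun n : ℝ => σ * v (-1) (P z' (e (s, n))) 2) (Icc (-r) r) := by
      intro z' _
      have hPc : Continuous (P z') := by
        have : P z' = fun q => WithLp.toLp 2 ![q.1, q.2, z'] := funext (hP z')
        rw [this]
        refine (PiLp.continuous_toLp 2 _).comp (continuous_pi fun i => ?_)
        fin_cases i <;> simp <;> fun_prop
      have hline : ContinuousOn (fun n : ℝ => e (s, n)) (Icc (-r) r) :=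
        e.continuousOn.comp (Continuous.continuousOn (by fun_prop)) fun n hn => hsrc ⟨hs, hn⟩
      exact continuousOn_const.mul ((hvc.comp hPc).comp_continuousOn hline)
    have hαz : |α s| * |z| ≤ κ s * r := by
      have h1 : |α s| * |z| ≤ A * (κ₀ * r / (A + 1)) :=
        mul_le_mul (hαA s hs) (hzδ'.trans hδ'A) (abs_nonneg _) hA
      have h2 : A * (κ₀ * r / (A + 1)) ≤ κ₀ * r := by
        rw [mul_div_assoc']
        rw [div_le_iff₀ (by linarith)]
        nlinarith [mul_nonneg hκ₀.le hr.le]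
      exact h1.trans (h2.trans (mul_le_mul_of_nonneg_right (hκ s hs) hr.le))
    have h := abs_sSup_sub_le_of_ridgeExpansion (g := fun n z' => σ * v (-1) (P z' (e (s, n))) 2) (δ := |z|)
      hκs hC₃ hr hthin_s (fun n z' _ _ => hexp s hs n z') hsec (le_refl |z|) hαz
    -- uniformise the constant
    have hcoef : (16 * C₃ * |α s| ^ 3 / κ s ^ 3 + 4 * C₃) * |z| ^ 3 ≤ C' * |z| ^ 3 := by
      refine mul_le_mul_of_nonneg_right ?_ (by positivity)
      rw [hC']
      have h1 : |α s| ^ 3 ≤ A ^ 3 := pow_le_pow_left₀ (abs_nonneg _) (hαA s hs) 3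
      have h2 : κ₀ ^ 3 ≤ κ s ^ 3 := pow_le_pow_left₀ hκ₀.le (hκ s hs) 3
      have h3 : 16 * C₃ * |α s| ^ 3 / κ s ^ 3 ≤ 16 * C₃ * A ^ 3 / κ₀ ^ 3 := by
        have hk3 : 0 < κ₀ ^ 3 := by positivity
        have hks3 : 0 < κ s ^ 3 := by positivity
        calc 16 * C₃ * |α s| ^ 3 / κ s ^ 3 ≤ 16 * C₃ * A ^ 3 / κ s ^ 3 :=
              div_le_div_of_nonneg_right (by nlinarith [mul_nonneg hC₃ (sub_nonneg.2 h1)]) hks3.le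
          _ ≤ 16 * C₃ * A ^ 3 / κ₀ ^ 3 := div_le_div_of_nonneg_left (by positivity) hk3 h2
      linarith
    have e1 : R s z - N - (α s ^ 2 / κ s + β s) / 2 * z ^ 2 = R s z - (N + (α s ^ 2 / κ s + β s) / 2 * z ^ 2) := by ring
    rw [e1]
    exact h.trans hcoef
  -- (Q2): pass to the coefficient
  exact quasiconvexOn_coeff_of_expansion (convex_Icc a₁ a₂) hδ'0 hexpR hqc

end Summit.NavierStokesRegularity.NavierStokesRegularity.Theorems.PoloidalWindowDoorLrcModEntireRidgeAssembly
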